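import Summits.ResolutionOfSingularities.ResolutionOfSingularities.Theorems.FrobeniusLadderFInjectiveMacaulayficationClosedPointLocalResolutionAdmTr
import Summits.ResolutionOfSingularities.ResolutionOfSingularities.Theorems.FrobeniusLadderFInjectiveMacaulayficationAdmissibleLocalCentre
import Summits.ResolutionOfSingularities.ResolutionOfSingularities.Theorems.FrobeniusLadderFInjectiveMacaulayficationLocalBlowupDesingularizationDimThree
import Literature.AlgebraicGeometry.Resolution.Temkin2008LocalizationProofs
import Literature.AlgebraicGeometry.Resolution.BirationalDimensionInequality
import HarnessLib

/-!
# THE T-HALF IS AT MOST RESOLUTION: `ClosedPointLocalResolutionAdmTr p e r` ⟸ resolution of `e`-folds over `k(X₁,…,X_r)`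
# (crux `FInjectiveMacaulayfication` stmt-ResolutionOfSingularities-15315, chain w45a; CHAIN v31.4 §(4) «E4 attack, memo-first: the first typed
# reduction of T(p,4,1)»; seat res-L1-w45a-stub-3 g9)

[OURS · L1 W4.5a] Support file (`--supports stmt-ResolutionOfSingularities-15315 --as helper`); replaces the role of NO printed item; NOT a statement of
any manuscript; ONE definition (`@[conjecture] def ResolutionTr`, OURS candidate, consumed only as a hypothesis; no instance, no notation, no named fact)
and theorems. AI-written (AI review is weaker than expert review).

WHAT. Door v38's resolution-side research stub reads (Mono p607809) `∀ p e, p.Prime → 4 ≤ e → ClosedPointLocalResolutionAdmTr p e 1` — at a CLOSED point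
`y` of an integral `e`-fold `Y` over `k(s)`, every ADMISSIBLE blowing up `S′ → Spec 𝒪_{Y,y}` regular off the closed fibre admits a desingularization. This file
proves the EASY direction of Temkin 2008 Prop. 2.3.4 ((ii) ⇒ (iii)), localized and with the dimension fixed:

* §1 `admitsDesingularization_of_flat_isPreimmersion` — desingularizations pull back along flat preimmersions (Temkin §2.1: pro-open pro-subschemes;
  `IsBlowup.pullback_snd_of_flat`, `mem_regularLocus_iff_of_flat_of_isPreimmersion`).
* §2 `exists_flat_isPreimmersion_to_blowup_of_isBlowup_stalk` — **every blowing up `S′ → Spec 𝒪_{Y,y}` along `I ≠ ⊥` is a pro-open pro-subscheme of a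
  blowing up `X′ → Y` along some `J ≠ ⊥`** (Temkin Lemma 2.1.1 `exists_idealSheaf_extension_fromSpecStalk` extends the centre; blow `Y` up along the
  extension, `exists_isBlowup`; flat base change `IsBlowup.pullback_snd_of_flat` and uniqueness `IsBlowup.unique` identify `S′` with `X′ ×_Y Spec 𝒪_{Y,y}`).
* §3 `ResolutionTr p e r` — [OURS · CANDIDATE] resolution of singularities (Temkin Def. 2.3.1/2.2.6: ONE blowing up with centre in the singular locus and
  regular source) of integral separated finite-type `e`-folds over `FractionRing (MvPolynomial (Fin r) k)`, `k` any field of characteristic `p` — the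
  quantifier prefix of `ClosedPointLocalResolutionAdmTr` verbatim; ★ `admitsDesingularization_of_isBlowup_stalk_of_resolutionTr` (ANY point, ANY blowing up)
  and ★ **`closedPointLocalResolutionAdmTr_of_resolutionTr : ResolutionTr p e r → ClosedPointLocalResolutionAdmTr p e r`**; door-stub form
  `stubTr_of_resolutionTr`.

HONEST READING (for res-L1-w45a-plan-1's residue wording). NONE of T's three restrictions (closed point, admissible centre, singularities over the closed
fibre) is consumed: T(p,e,r) sits below plain resolution of `e`-folds over `k(X₁,…,X_r)`. Conversely Temkin's Prop. 2.3.4 at `d = e + 1` (the tree discharges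
`d = ∞` only, `Temkin2008_prop234_holds`) with Cossart–Piltant below dimension 4 gives resolution of 4-folds over `k(s)` from {T(p,e′,r′) : e′ ≤ 4} — so
T(p,4,1) is of RESOLUTION strength (resolution of 4-folds over the fields `k(s)`), not of local-uniformization strength; the memo
`L/res-L1-w45a-stub-3/T-HALF-REDUCTIONS.md` records this and the typed reductions below it.
[folklore assembly; cite: Temkin2008, §2.1 Lemma 2.1.1, Def. 2.2.6, Def. 2.3.1, Prop. 2.3.4 ((ii)⇒(iii))] [cite: GortzWedhorn2020, Prop. 13.91; (13.19)]
[cite: StacksProject, Tag 01J7; Tag 02OS]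
-/

-- single-problem summit: the doubled namespace component is forced
set_option linter.dupNamespace false

noncomputable section

namespace Summit.ResolutionOfSingularities.ResolutionOfSingularities.Theorems.FInjectiveMacaulayfication.TrOfResolution

open CategoryTheory CategoryTheory.Limits AlgebraicGeometry TopologicalSpace IsLocalRing
open Literature.AlgebraicGeometry.Resolution
open Summit.ResolutionOfSingularities.ResolutionOfSingularities.Theorems.FInjectiveMacaulayfication

universe u

/-! ## §1 Desingularizations pull back along flat preimmersions -/

/-- **Desingularizations pull back along flat preimmersions** (pro-open pro-subschemes, Temkin 2008 §2.1): if `q : S′ ⟶ X′` is flat and a preimmersion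
and `X′` admits a desingularization `X″ = Bl_𝓙 X′ → X′` (`Supp 𝓙 ⊆ Sing X′`, `X″` regular), then `X″ ×_{X′} S′ → S′` is a blowing up along `q⁻¹𝓙`
(flat base change), its centre lies in `Sing S′` and its source is regular (local rings along `q` and its base change are those of `X′`, `X″`).
[folklore; cite: Temkin2008, §2.1 and Prop. 2.3.4 (proof, p. 12)] [cite: GortzWedhorn2020, Prop. 13.91 (2)] -/
theorem admitsDesingularization_of_flat_isPreimmersion {S' X' : Scheme.{u}} (q : S' ⟶ X') [Flat q] [IsPreimmersion q]
    (h : Scheme.AdmitsDesingularization X') : Scheme.AdmitsDesingularization S' := by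
  obtain ⟨X'', π, hdes⟩ := h
  obtain ⟨J, hπ, hJ⟩ := hdes.exists_isBlowup
  refine ⟨pullback π q, pullback.snd π q, ⟨⟨J.comap q, hπ.pullback_snd_of_flat q,
    AdmissibleLocalCentre.support_comap_subset_of_flat_of_isPreimmersion q J hJ⟩, fun t => ?_⟩⟩
  exact (Scheme.mem_regularLocus t).mp
    ((mem_regularLocus_iff_of_flat_of_isPreimmersion (pullback.fst π q) t).mpr (hdes.isRegular _))

/-! ## §2 A local blowing up is a pro-open pro-subscheme of a global blowing up -/

/-- **Every blowing up of `Spec 𝒪_{Y,y}` along `I ≠ ⊥` is a pro-open pro-subscheme of a blowing up of `Y` along some `J ≠ ⊥`** (`Y` locally Noetherian):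
there are a blowing up `f′ : X′ → Y` along `J ≠ ⊥` and a flat preimmersion `q : S′ ⟶ X′`. Construction: transport `I` to `P = Y ×_Y Spec 𝒪_{Y,y}`, extend it
to `J` on `Y` (Temkin Lemma 2.1.1), blow `Y` up along `J`; `X′ ×_Y P → P` is a blowing up along the restriction of `J`, i.e. along (the transport of) `I`
(flat base change), hence isomorphic to `S′` (uniqueness of blowing ups); `q` is that isomorphism followed by the projection to `X′`.
[folklore; cite: Temkin2008, Lemma 2.1.1; Prop. 2.3.4 (proof)] [cite: GortzWedhorn2020, Prop. 13.91 (2); (13.19)] -/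
theorem exists_flat_isPreimmersion_to_blowup_of_isBlowup_stalk {Y : Scheme.{u}} [IsLocallyNoetherian Y] (y : Y)
    {S' : Scheme.{u}} {g : S' ⟶ Spec (Y.presheaf.stalk y)} {I : (Spec (Y.presheaf.stalk y)).IdealSheafData} (hg : IsBlowup g I) (hI : I ≠ ⊥) :
    ∃ (X' : Scheme.{u}) (f' : X' ⟶ Y) (J : Y.IdealSheafData) (q : S' ⟶ X'), IsBlowup f' J ∧ J ≠ ⊥ ∧ Flat q ∧ IsPreimmersion q := by
  haveI : Flat (Y.fromSpecStalk y) := flat_fromSpecStalk Y y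
  -- `P = Y ×_Y Spec 𝒪_{Y,y}` with its two projections `t`, `s` (`s` an isomorphism)
  set t : pullback (𝟙 Y) (Y.fromSpecStalk y) ⟶ Y := pullback.fst (𝟙 Y) (Y.fromSpecStalk y) with ht
  set s : pullback (𝟙 Y) (Y.fromSpecStalk y) ⟶ Spec (Y.presheaf.stalk y) := pullback.snd (𝟙 Y) (Y.fromSpecStalk y) with hs
  haveI : IsIso s := by rw [hs]; infer_instance
  -- `g ≫ s⁻¹ : S′ → P` is a blowing up along `I₁ := s⁻¹ I`
  have hsq : IsPullback (𝟙 S') (g ≫ inv s) g s := IsPullback.of_horiz_isIso ⟨by simp⟩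
  have hg₁ : IsBlowup (g ≫ inv s) (I.comap s) := hg.of_isPullback_of_flat hsq
  have hI₁ : I.comap s ≠ ⊥ := by
    intro h
    apply hI
    have : I = (I.comap s).comap (inv s) := by
      rw [← Scheme.IdealSheafData.comap_comp, IsIso.inv_hom_id, Scheme.IdealSheafData.comap_id]
    rw [this, h, Scheme.IdealSheafData.comap_bot]
  -- extend `I₁` to `J` on `Y` (Temkin Lemma 2.1.1) and blow `Y` up along `J`
  haveI : IsNoetherian (pullback (𝟙 Y) (Y.fromSpecStalk y)) := by
    haveI : IsLocallyNoetherian (pullback (𝟙 Y) (Y.fromSpecStalk y)) := LocallyOfFiniteType.isLocallyNoetherian s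
    haveI : CompactSpace ↑(pullback (𝟙 Y) (Y.fromSpecStalk y)) := QuasiCompact.compactSpace_of_compactSpace s
    exact {}
  obtain ⟨J, hJI, -⟩ := exists_idealSheaf_extension_fromSpecStalk (𝟙 Y) y (I.comap s)
  obtain ⟨X', f', hf'⟩ := exists_isBlowup Y J
  have hJ : J ≠ ⊥ := by
    intro h
    apply hI₁
    rw [← hJI, h, Scheme.IdealSheafData.comap_bot]
  -- `X′ ×_Y P → P` is a blowing up along `J|_P = I₁`, hence isomorphic to `S′`
  have hP' : IsBlowup (pullback.snd f' t) (I.comap s) := by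
    rw [← hJI]
    exact hf'.pullback_snd_of_flat t
  obtain ⟨e, -, -⟩ := hg₁.unique hP'
  exact ⟨X', f', J, e.hom ≫ pullback.fst f' t, hf', hJ, inferInstance, inferInstance⟩

/-! ## §3 The resolution rung over `k(X₁,…,X_r)` and the T-half below it -/

/-- [OURS · CANDIDATE statement] **`ResolutionTr p e r` — RESOLUTION OF `e`-FOLDS OVER `k(X₁,…,X_r)`** (Temkin Def. 2.3.1 with Def. 2.2.6, dimension fixed):
for every field `k` of characteristic `p`, with `K := FractionRing (MvPolynomial (Fin r) k)`, every INTEGRAL separated finite-type `K`-scheme `Y` with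
`dim Y = e` admits a desingularization — ONE blowing up `Y′ → Y` with centre inside the singular locus and `Y′` regular. Same quantifier prefix as
`ClosedPointLocalResolutionAdmTr p e r`; consumed only as a hypothesis (`closedPointLocalResolutionAdmTr_of_resolutionTr`). Open for `e ≥ 4` in
characteristic `p > 0`; for `e ≤ 3` it is Cossart–Piltant 2019 Thm. 1.1. [candidate statement, OURS; cite: Temkin2008, Def. 2.3.1; Def. 2.2.6] -/
@[conjecture] def ResolutionTr (p e r : ℕ) : Prop :=
  ∀ (k : Type) [Field k] [CharP k p] (Y : Scheme.{0}) (g : Y ⟶ Spec (.of (FractionRing (MvPolynomial (Fin r) k)))),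
    IsSeparated g → LocallyOfFiniteType g → QuasiCompact g → IsIntegral Y → topologicalKrullDim Y = e →
    Scheme.AdmitsDesingularization Y

/-- ★ **Resolution of `e`-folds over `K` desingularizes EVERY blowing up of EVERY local scheme `Spec 𝒪_{Y,y}` of an `e`-fold over `K`** — any point `y`
(closed or not), any centre `I` (admissible or not, no fibre condition): Temkin 2008 Prop. 2.3.4 (ii) ⇒ (iii), localized at dimension `e`. If `I = ⊥` the
blowing up is empty; otherwise §2 presents `S′` as a pro-open pro-subscheme of a blowing up `X′ → Y` along `J ≠ ⊥` — `X′` is again an integral separated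
finite-type `K`-scheme of dimension `e` (`IsBlowup.isIntegral`, `IsBlowup.isProper`, `IsBirational.topologicalKrullDim_eq_of_isProper`) — and §1 pulls a
desingularization of `X′` back to `S′`. [folklore; cite: Temkin2008, Prop. 2.3.4 ((ii)⇒(iii))] -/
theorem admitsDesingularization_of_isBlowup_stalk_of_resolution {K : Type} [Field K] {e : ℕ}
    (hRes : ∀ (X : Scheme.{0}) (f : X ⟶ Spec (.of K)), IsSeparated f → LocallyOfFiniteType f → QuasiCompact f → IsIntegral X →
      topologicalKrullDim X = e → Scheme.AdmitsDesingularization X)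
    {Y : Scheme.{0}} (g : Y ⟶ Spec (.of K)) [IsSeparated g] [LocallyOfFiniteType g] [QuasiCompact g] [IsIntegral Y]
    (he : topologicalKrullDim Y = e) (y : Y)
    (S' : Scheme.{0}) (g' : S' ⟶ Spec (Y.presheaf.stalk y)) (I : (Spec (Y.presheaf.stalk y)).IdealSheafData) (hg' : IsBlowup g' I) :
    Scheme.AdmitsDesingularization S' := by
  classical
  haveI : IsLocallyNoetherian Y := LocallyOfFiniteType.isLocallyNoetherian g
  by_cases hI : I = ⊥
  · subst hI
    haveI := LocalBlowupDesingularizationDimThree.isEmpty_of_isBlowup_bot hg'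
    exact LocalBlowupDesingularizationDimThree.admitsDesingularization_of_isEmpty S'
  obtain ⟨X', f', J, q, hf', hJ, hq, hq'⟩ := exists_flat_isPreimmersion_to_blowup_of_isBlowup_stalk y hg' hI
  -- `X′` is an integral separated finite-type `K`-scheme of dimension `e`
  haveI : IsIntegral X' := hf'.isIntegral hJ
  haveI : IsProper f' := hf'.isProper
  have hdim : topologicalKrullDim X' = e := by
    rw [(hf'.isBirational' hJ).topologicalKrullDim_eq_of_isProper, he]
  have hX' : Scheme.AdmitsDesingularization X' :=
    hRes X' (f' ≫ g) inferInstance inferInstance inferInstance inferInstance hdim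
  exact admitsDesingularization_of_flat_isPreimmersion q hX'

/-- ★ The same over `K = k(X₁,…,X_r)` from the rung `ResolutionTr p e r`. [folklore; cite: Temkin2008, Prop. 2.3.4 ((ii)⇒(iii))] -/
theorem admitsDesingularization_of_isBlowup_stalk_of_resolutionTr {p e r : ℕ} (h : ResolutionTr p e r)
    (k : Type) [Field k] [CharP k p] {Y : Scheme.{0}} (g : Y ⟶ Spec (.of (FractionRing (MvPolynomial (Fin r) k))))
    [IsSeparated g] [LocallyOfFiniteType g] [QuasiCompact g] [IsIntegral Y] (he : topologicalKrullDim Y = e) (y : Y)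
    (S' : Scheme.{0}) (g' : S' ⟶ Spec (Y.presheaf.stalk y)) (I : (Spec (Y.presheaf.stalk y)).IdealSheafData) (hg' : IsBlowup g' I) :
    Scheme.AdmitsDesingularization S' :=
  admitsDesingularization_of_isBlowup_stalk_of_resolution
    (fun X f hs hl hq hi hd => h k X f hs hl hq hi hd) g he y S' g' I hg'

/-- ★★ **THE T-HALF IS AT MOST RESOLUTION: `ResolutionTr p e r → ClosedPointLocalResolutionAdmTr p e r`.** The closedness of `y`, the admissibility of
the centre and the fibre condition of T are simply dropped. [folklore; cite: Temkin2008, Prop. 2.3.4 ((ii)⇒(iii))] -/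
theorem closedPointLocalResolutionAdmTr_of_resolutionTr {p e r : ℕ} (h : ResolutionTr p e r) :
    ClosedPointLocalResolutionAdmTr.ClosedPointLocalResolutionAdmTr p e r := by
  intro k _ _ Y g hs hl hq hi hd y _ S' g' I hg' _ _
  exact admitsDesingularization_of_isBlowup_stalk_of_resolutionTr h k g hd y S' g' I hg'

/-- **Door v38's resolution-side stub from the resolution rungs** (`e ≥ 4`, `r ≥ 1`): `stub_closedPointLocalResolutionAdmTr` ⟸ {ResolutionTr p e r}.
[folklore; plumbing] -/
theorem stubTr_of_resolutionTr (h : ∀ p e r : ℕ, p.Prime → 4 ≤ e → 1 ≤ r → ResolutionTr p e r) :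
    ∀ p e r : ℕ, p.Prime → 4 ≤ e → 1 ≤ r → ClosedPointLocalResolutionAdmTr.ClosedPointLocalResolutionAdmTr p e r :=
  fun p e r hp he hr => closedPointLocalResolutionAdmTr_of_resolutionTr (h p e r hp he hr)

/-- **(LR_adm) from the resolution rungs** `e ≥ 4`, `r ≥ 1`. [folklore; plumbing] -/
theorem localResolutionNonClosedGe4Adm_of_resolutionTr (h : ∀ p e r : ℕ, p.Prime → 4 ≤ e → 1 ≤ r → ResolutionTr p e r) :
    RegularOffFiniteOfLRAdm.LocalResolutionNonClosedGe4Adm :=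
  ClosedPointLocalResolutionAdmTr.localResolutionNonClosedGe4Adm_of_tr (stubTr_of_resolutionTr h)

end Summit.ResolutionOfSingularities.ResolutionOfSingularities.Theorems.FInjectiveMacaulayfication.TrOfResolution

end
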